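import Mathlib
import HarnessLib
import Summits.HubbardSuperconductivity.HubbardSuperconductivity.Theorems.KLProgrammeKLRegimeSplitPhRotationPlanar
import Summits.HubbardSuperconductivity.HubbardSuperconductivity.Theorems.KLProgrammeLatticeMatsubaraBubble

/-!
# Route `KLProgramme` — ENGINE (stmt-HubbardSuperconductivity-20437 `KLRegimeEngineV17F2`), row (c) binder #8 (v19 `hexLadMV`'s VALUE rows `RP RQ`), cure of located #23,
# brick O6b: THE PARTICLE–HOLE ROTATION LEMMA ON THE MODEL CARRIER `MatsubaraIdx M × TorusSite 2 L` — planar bound (O6a) `+ (r₂/π + 3/β)·2πK/L`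
# (cell gate-hubbard-kl, seat hubbard-kl-k3c2-p2 g31, technique «thermal-bar induction n ≤ nScales β + 1 with EngineBoundsAtV4S sums»)

WHY.  O6a (`klph_planar_rotation_le`) bounds the Matsubara-summed PLANAR zero-transfer p-h bubble with a radial slice weight by thermal + DOS-slope sizes.  The rows
door's `RP/RQ` live on the torus momenta; this file carries the planar bound to the lattice by the lane's standard device `klfl_matsubara_latticeAverage_norm_le`
(continuous doubly-periodic `K`-Lipschitz integrand agreeing with its square-cut version; rate `(r₂/π + 3/β)·2πK/L`), and rewrites the result through
`klod_sum_even_mul_propCT_sq` as a statement about `Σ_p G(ω_p² + e_K(p)²)·ĝ_K(p)²`: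

* §1 `klph_f_lipschitz_level` — the level-Lipschitz twin of `klph_f_lipschitz_freq` (`|f(ω,e) − f(ω,e′)| ≤ 2r₂L⋆|e − e′|`, all `ω`);
  `klph_F_planar_*` — the per-frequency planar integrand `p ↦ f(ω_i, e_K(p))`: continuity, double `2π`-periodicity, sup-metric Lipschitz constant `2r₂L⋆·(4 + 2A)`,
  vanishing for `|ω_i| ≥ r₂`, and `∫_{[−π,π]²} = ∫_{tube}` (the weight vanishes off the shell `|e_K| < r₂ < r`);
* §2 **`klph_lattice_rotation_le`** — `|β⁻¹ Σ_i (L²)⁻¹ Σ_k̃ f(ω_i, e_K(p_k̃))| ≤ (2π)⁻²·𝔅₆ₐ + (r₂/π + 3/β)·2π·(2r₂L⋆(4 + 2A))/L`;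
* §3 **`klph_lattice_rotation_propCT_sq_le`** — the same for `‖β⁻¹(L²)⁻¹ Σ_{(ν,k̃)} G(ω_ν² + e_K(p_k̃)²)·ĝ_K(ν,k̃)²‖` (O1 §5 dictionary): the leading
  (frequency-pinned-kernel) part of `RP`/`RQ` at the diagonal pinned pair is THERMAL + DOS-SLOPE + LATTICE sized — located #23 §3's three homes
  (`thermalBar`, `frameShiftBar`, volume share) as a theorem on the model carrier.
Pure composition; no definitions; nothing asserts (c), K3 or superconductivity.  [cite: BenfattoGiulianiMastropietro2006, §2.4–§2.5]
-/

noncomputable section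

namespace Summit.HubbardSuperconductivity.HubbardSuperconductivity.Theorems.KLRegimeSplit

set_option linter.dupNamespace false -- summit = problem name (single-conjunct summit), D-0017

open Real Set Finset MeasureTheory Literature.MathematicalPhysics.QuantumLattice Literature.Probability.LatticeModels
open Literature.MathematicalPhysics.QuantumLattice.BandSectorCounting
open Summit.HubbardSuperconductivity.HubbardSuperconductivity.Theorems.TwoPointAssembly
open Summit.HubbardSuperconductivity.HubbardSuperconductivity.Theorems.EngineV8
open Summit.HubbardSuperconductivity.HubbardSuperconductivity.Theorems.DispersionFlow
open Summit.HubbardSuperconductivity.HubbardSuperconductivity.Theorems.PerturbedFermiCurve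
open Summit.HubbardSuperconductivity.HubbardSuperconductivity.Theorems.C4a

/-! ## §1 The per-frequency planar integrand `p ↦ f(ω, e_K(p))` -/

/-- **Level-Lipschitz bound, uniformly in the frequency**: `|f(ω,e) − f(ω,e′)| ≤ 2r₂L⋆|e − e′|` (for `|ω| ≤ r₂` by the profile
`s ↦ G(s)/s − 2ω²·G(s)/s²` and `klrm_radial_lipschitz_fst`; for `|ω| ≥ r₂` both values vanish). -/
theorem klph_f_lipschitz_level {G : ℝ → ℝ} {Mg ℓ r₁ r₂ : ℝ} (hbd : ∀ s, |G s| ≤ Mg) (hlip : ∀ s s', |G s - G s'| ≤ ℓ * |s - s'|)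
    (hin : ∀ s, s ≤ r₁ ^ 2 → G s = 0) (hout : ∀ s, r₂ ^ 2 ≤ s → G s = 0) (hr₁ : 0 < r₁) (hr₂ : 0 ≤ r₂) (ω e e' : ℝ) :
    |G (ω ^ 2 + e ^ 2) * (e ^ 2 - ω ^ 2) / (ω ^ 2 + e ^ 2) ^ 2 - G (ω ^ 2 + e' ^ 2) * (e' ^ 2 - ω ^ 2) / (ω ^ 2 + e' ^ 2) ^ 2| ≤
      2 * r₂ * (2 * r₂ ^ 2 * (ℓ / r₁ ^ 4 + 2 * Mg / r₁ ^ 6) + (ℓ / r₁ ^ 2 + Mg / r₁ ^ 4)) * |e - e'| := by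
  have hMg : 0 ≤ Mg := (abs_nonneg _).trans (hbd 0)
  have hℓ : 0 ≤ ℓ := by
    have h := hlip 0 1; have h0 : 0 ≤ |G 0 - G 1| := abs_nonneg _; norm_num at h; linarith
  rcases le_or_gt (|ω|) r₂ with hω | hω
  · have hω2 : ω ^ 2 ≤ r₂ ^ 2 := by nlinarith [abs_nonneg ω, sq_abs ω]
    have hN : ∀ s s', |(G s / s - 2 * ω ^ 2 * (G s / s ^ 2)) - (G s' / s' - 2 * ω ^ 2 * (G s' / s' ^ 2))| ≤
        (2 * r₂ ^ 2 * (ℓ / r₁ ^ 4 + 2 * Mg / r₁ ^ 6) + (ℓ / r₁ ^ 2 + Mg / r₁ ^ 4)) * |s - s'| := by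
      intro s s'
      have h1 := klok_divSq_lipschitz hbd hlip hin hr₁ s s'
      have h2 := klok_div_lipschitz hbd hlip hin hr₁ s s'
      calc |(G s / s - 2 * ω ^ 2 * (G s / s ^ 2)) - (G s' / s' - 2 * ω ^ 2 * (G s' / s' ^ 2))|
          = |(G s / s - G s' / s') - 2 * ω ^ 2 * (G s / s ^ 2 - G s' / s' ^ 2)| := by ring_nf
        _ ≤ |G s / s - G s' / s'| + 2 * ω ^ 2 * |G s / s ^ 2 - G s' / s' ^ 2| := by
            refine (abs_sub _ _).trans ?_
            rw [abs_mul, abs_of_nonneg (by positivity : (0:ℝ) ≤ 2 * ω ^ 2)]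
        _ ≤ (ℓ / r₁ ^ 2 + Mg / r₁ ^ 4) * |s - s'| + 2 * r₂ ^ 2 * ((ℓ / r₁ ^ 4 + 2 * Mg / r₁ ^ 6) * |s - s'|) := by
            gcongr
        _ = _ := by ring
    have hNout : ∀ s, r₂ ^ 2 ≤ s → (G s / s - 2 * ω ^ 2 * (G s / s ^ 2)) = 0 := fun s hs => by simp [hout s hs]
    have hL : 0 ≤ 2 * r₂ ^ 2 * (ℓ / r₁ ^ 4 + 2 * Mg / r₁ ^ 6) + (ℓ / r₁ ^ 2 + Mg / r₁ ^ 4) := by positivity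
    have h := klrm_radial_lipschitz_fst (N := fun s => G s / s - 2 * ω ^ 2 * (G s / s ^ 2)) hN hL hNout hr₂ ω e e'
    have hprof : ∀ x, G (ω ^ 2 + x ^ 2) * (x ^ 2 - ω ^ 2) / (ω ^ 2 + x ^ 2) ^ 2 =
        (fun s : ℝ => G s / s - 2 * ω ^ 2 * (G s / s ^ 2)) (x ^ 2 + ω ^ 2) := by
      intro x
      rcases eq_or_ne (ω ^ 2 + x ^ 2) 0 with h0 | h0
      · have h0' : x ^ 2 + ω ^ 2 = 0 := by linarith
        rw [h0, h0']; simp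
      · simp only [add_comm (x ^ 2) (ω ^ 2)]; field_simp; ring
    rw [hprof e, hprof e']
    beta_reduce at h ⊢
    exact h
  · rw [klph_f_zero_of_freq hout hr₂ hω.le, klph_f_zero_of_freq hout hr₂ hω.le, sub_zero, abs_zero]; positivity

section Chart

variable {a b : ℝ} (B : BandBounds a b) {K : TrigPolyC4v} {A : ℝ}
  (hA : ∀ p : Momentum, ∀ j ≤ 2, ‖iteratedFDeriv ℝ j (frameShift K) p‖ ≤ A) (hADt : 2 * A < B.Dtmin)
  {μ r : ℝ} (hlo : a < μ - r - A) (hhi : μ + r + A < b)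
include B hA hADt hlo hhi

omit B hA hADt hlo hhi in
/-- **The square integral of the planar integrand is its tube integral** (the weight vanishes off the shell `|e_K| < r₂ < r`; the square's boundary is null). -/
theorem klph_integral_square_eq_tube {G : ℝ → ℝ} {r₂ : ℝ} (hout : ∀ s, r₂ ^ 2 ≤ s → G s = 0) (hr₂ : 0 ≤ r₂) (hr₂r : r₂ < r) (ω : ℝ) :
    ∫ p in Icc (-π) π ×ˢ Icc (-π) π, G (ω ^ 2 + frameLevel μ K (WithLp.toLp 2 ![p.1, p.2]) ^ 2) * (frameLevel μ K (WithLp.toLp 2 ![p.1, p.2]) ^ 2 - ω ^ 2) /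
        (ω ^ 2 + frameLevel μ K (WithLp.toLp 2 ![p.1, p.2]) ^ 2) ^ 2 =
      ∫ q in {q : ℝ × ℝ | |q.1| < π ∧ |q.2| < π ∧ |frameLevel μ K (WithLp.toLp 2 ![q.1, q.2])| < r},
        G (ω ^ 2 + frameLevel μ K (WithLp.toLp 2 ![q.1, q.2]) ^ 2) * (frameLevel μ K (WithLp.toLp 2 ![q.1, q.2]) ^ 2 - ω ^ 2) /
          (ω ^ 2 + frameLevel μ K (WithLp.toLp 2 ![q.1, q.2]) ^ 2) ^ 2 := by
  have hopen : {q : ℝ × ℝ | |q.1| < π ∧ |q.2| < π ∧ |frameLevel μ K (WithLp.toLp 2 ![q.1, q.2])| < r} ⊆ Ioo (-π) π ×ˢ Ioo (-π) π :=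
    fun q hq => mk_mem_prod (abs_lt.1 hq.1) (abs_lt.1 hq.2.1)
  have hae : (Ioo (-π) π ×ˢ Ioo (-π) π : Set (ℝ × ℝ)) =ᵐ[volume] (Icc (-π) π ×ˢ Icc (-π) π : Set (ℝ × ℝ)) := by
    rw [Measure.volume_eq_prod]
    exact Measure.set_prod_ae_eq (Ioo_ae_eq_Icc (μ := (volume : Measure ℝ))) (Ioo_ae_eq_Icc (μ := (volume : Measure ℝ)))
  rw [← setIntegral_congr_set hae, setIntegral_eq_of_subset_of_forall_sdiff_eq_zero (measurableSet_Ioo.prod measurableSet_Ioo) hopen]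
  intro q hq
  have hq1 : |q.1| < π := abs_lt.2 (mem_prod.1 hq.1).1
  have hq2 : |q.2| < π := abs_lt.2 (mem_prod.1 hq.1).2
  have hnot : ¬ |frameLevel μ K (WithLp.toLp 2 ![q.1, q.2])| < r := fun h => hq.2 ⟨hq1, hq2, h⟩
  exact klph_f_zero_of_level hout hr₂ ω ((le_of_lt hr₂r).trans (not_lt.1 hnot))

/-! ## §2 THE ROTATION LEMMA ON THE MODEL CARRIER -/

/-- **THE PARTICLE–HOLE ROTATION LEMMA ON THE TORUS MOMENTA.**  Under the hypotheses of `klph_planar_rotation_le` (C4a chart, slice weight `G`,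
`0 < r₂ < r`, `0 < β`, `βr₂/(2π) + 1 ≤ M`), for every `L`:
`|β⁻¹ Σ_i (L²)⁻¹ Σ_k̃ f(ω_i, e_K(p_k̃))| ≤ (2π)⁻²·𝔅₆ₐ + (r₂/π + 3/β)·(2π·(2r₂L⋆(4 + 2A))/L)`, `𝔅₆ₐ` the planar bound, `e_K(p_k̃) = nambuXiCT L μ K k̃`.
[cite: BenfattoGiulianiMastropietro2006, §2.4–§2.5] -/
theorem klph_lattice_rotation_le {M : ℕ} {β : ℝ} (hβ : 0 < β) {G : ℝ → ℝ} {Mg ℓ r₁ r₂ : ℝ} (hbd : ∀ s, |G s| ≤ Mg)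
    (hlip : ∀ s s', |G s - G s'| ≤ ℓ * |s - s'|) (hin : ∀ s, s ≤ r₁ ^ 2 → G s = 0) (hout : ∀ s, r₂ ^ 2 ≤ s → G s = 0)
    (hr₁ : 0 < r₁) (hr₂ : 0 < r₂) (hr₂r : r₂ < r) (hM : β * r₂ / (2 * Real.pi) + 1 ≤ M) (L : ℕ) [NeZero L] :
    |β⁻¹ * ∑ i : MatsubaraIdx M, ((L ^ 2 : ℕ) : ℝ)⁻¹ * ∑ k : TorusSite 2 L,
        G (matsubaraFreq β M i ^ 2 + nambuXiCT L μ K k ^ 2) * (nambuXiCT L μ K k ^ 2 - matsubaraFreq β M i ^ 2) /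
          (matsubaraFreq β M i ^ 2 + nambuXiCT L μ K k ^ 2) ^ 2| ≤
      ((2 * π) ^ 2)⁻¹ * (2 * π * (π * Real.sqrt 2 / (B.Dtmin - 2 * A)) *
            ((2 * r₂ * (2 * r₂ * (2 * r₂ ^ 2 * (ℓ / r₁ ^ 4 + 2 * Mg / r₁ ^ 6) + (ℓ / r₁ ^ 2 + Mg / r₁ ^ 4)))) * (r₂ + 2 * Real.pi / β) / β) +
          β⁻¹ * ((r₂ * β / π + 1) * (2 * r₂ * (2 * π * (1 / (B.Dtmin - 2 * A) ^ 2 + Real.pi * Real.sqrt 2 * (2 + 4 * A) / (B.Dtmin - 2 * A) ^ 3) * r₂ *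
            (Mg / r₁ ^ 2))))) +
        (r₂ / π + 3 / β) * (2 * π * (2 * r₂ * (2 * r₂ ^ 2 * (ℓ / r₁ ^ 4 + 2 * Mg / r₁ ^ 6) + (ℓ / r₁ ^ 2 + Mg / r₁ ^ 4)) * (4 + 2 * A)) / L) := by
  have hπ := Real.pi_pos
  have hA0 : 0 ≤ A := le_trans (norm_nonneg _) (hA 0 0 (by norm_num))
  have hMg : 0 ≤ Mg := (abs_nonneg _).trans (hbd 0)
  have hℓ : 0 ≤ ℓ := by
    have h := hlip 0 1; have h0 : 0 ≤ |G 0 - G 1| := abs_nonneg _; norm_num at h; linarith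
  have hKnn : 0 ≤ 2 * r₂ * (2 * r₂ ^ 2 * (ℓ / r₁ ^ 4 + 2 * Mg / r₁ ^ 6) + (ℓ / r₁ ^ 2 + Mg / r₁ ^ 4)) * (4 + 2 * A) := by positivity
  obtain ⟨f, hf⟩ : ∃ f : ℝ → ℝ → ℝ, ∀ ω e, f ω e = G (ω ^ 2 + e ^ 2) * (e ^ 2 - ω ^ 2) / (ω ^ 2 + e ^ 2) ^ 2 := ⟨_, fun _ _ => rfl⟩
  set eK : ℝ × ℝ → ℝ := fun p => frameLevel μ K (WithLp.toLp 2 ![p.1, p.2]) with heK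
  -- the per-frequency planar integrand and its square-cut version
  set F : MatsubaraIdx M → ℝ × ℝ → ℝ := fun i p => f (matsubaraFreq β M i) (eK p) with hF
  set h : MatsubaraIdx M → ℝ × ℝ → ℝ := fun i => (Icc (-π) π ×ˢ Icc (-π) π).indicator (F i) with hh
  have hfcont : Continuous fun p : ℝ × ℝ => f p.1 p.2 := by
    have := klph_f_continuous hbd hlip hin hr₁; refine this.congr fun p => ?_; simp only [hf]
  have heKc : Continuous eK := continuous_frameLevel_coord' (K := K) (μ := μ)
  have hFc : ∀ i, Continuous (F i) := fun i => hfcont.comp (continuous_const.prodMk heKc)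
  have h1 : ∀ i x y, F i (x + 2 * π, y) = F i (x, y) := fun i x y => by
    simp only [hF, heK]
    exact congrArg (f _) (frameLevel_coord_add_two_pi_fst (K := K) (μ := μ) (x, y))
  have h2 : ∀ i x y, F i (x, y + 2 * π) = F i (x, y) := fun i x y => by
    simp only [hF, heK]
    exact congrArg (f _) (frameLevel_coord_add_two_pi_snd (K := K) (μ := μ) (x, y))
  have heKlip : ∀ p q : ℝ × ℝ, |eK p - eK q| ≤ (4 + 2 * A) * dist p q := by
    intro p q
    have hκ : ∀ x : Fin 2 → ℝ, ‖fderiv ℝ (fun x : Fin 2 → ℝ => -K.eval x) x‖ ≤ 2 * A := fun x => by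
      rw [← frameShift_toLp_eq_neg_eval]; exact norm_fderiv_frameShift_toLp_le hA x
    have h := abs_planarBand_sub_le hκ μ (0 : Fin 2 → ℝ) p q
    simp only [sub_zero] at h
    simp only [heK, frameLevel_coord_eq_planarBand]
    exact h
  have hlipF : ∀ i (p q : ℝ × ℝ), ‖F i p - F i q‖ ≤ (Real.toNNReal (2 * r₂ * (2 * r₂ ^ 2 * (ℓ / r₁ ^ 4 + 2 * Mg / r₁ ^ 6) + (ℓ / r₁ ^ 2 + Mg / r₁ ^ 4)) * (4 + 2 * A)) : ℝ) * dist p q := by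
    intro i p q
    rw [Real.coe_toNNReal _ hKnn, Real.norm_eq_abs, hF]
    have h := klph_f_lipschitz_level hbd hlip hin hout hr₁ hr₂.le (matsubaraFreq β M i) (eK p) (eK q)
    simp only [← hf] at h
    calc _ ≤ 2 * r₂ * (2 * r₂ ^ 2 * (ℓ / r₁ ^ 4 + 2 * Mg / r₁ ^ 6) + (ℓ / r₁ ^ 2 + Mg / r₁ ^ 4)) * |eK p - eK q| := h
      _ ≤ 2 * r₂ * (2 * r₂ ^ 2 * (ℓ / r₁ ^ 4 + 2 * Mg / r₁ ^ 6) + (ℓ / r₁ ^ 2 + Mg / r₁ ^ 4)) * ((4 + 2 * A) * dist p q) := mul_le_mul_of_nonneg_left (heKlip p q) (by positivity)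
      _ = _ := by ring
  have hFh : ∀ i, ∀ p ∈ Icc (-π) π ×ˢ Icc (-π) π, F i p = h i p := fun i p hp => by simp only [hh, Set.indicator_of_mem hp]
  have hh0 : ∀ i, ∀ p ∉ Icc (-π) π ×ˢ Icc (-π) π, h i p = 0 := fun i p hp => by simp only [hh, Set.indicator_of_notMem hp]
  have hzero : ∀ i, r₂ ≤ |matsubaraFreq β M i| → ∀ p, F i p = 0 := fun i hi p => by
    simp only [hF, hf]; exact klph_f_zero_of_freq hout hr₂.le hi _
  -- the planar bound
  have hplanar := klph_planar_rotation_le B hA hADt hlo hhi hβ hbd hlip hin hout hr₁ hr₂ hr₂r hM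
  have hint : ∀ i, ∫ p, h i p = ∫ q in {q : ℝ × ℝ | |q.1| < π ∧ |q.2| < π ∧ |frameLevel μ K (WithLp.toLp 2 ![q.1, q.2])| < r},
      f (matsubaraFreq β M i) (eK q) := by
    intro i
    rw [hh, integral_indicator (measurableSet_Icc.prod measurableSet_Icc)]
    have := klph_integral_square_eq_tube (K := K) (μ := μ) (r := r) hout hr₂.le hr₂r (matsubaraFreq β M i)
    simp only [hF, heK, hf]
    exact this
  have hB : ‖β⁻¹ • ∑ i : MatsubaraIdx M, ∫ p, h i p‖ ≤
      (2 * π * (π * Real.sqrt 2 / (B.Dtmin - 2 * A)) *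
            ((2 * r₂ * (2 * r₂ * (2 * r₂ ^ 2 * (ℓ / r₁ ^ 4 + 2 * Mg / r₁ ^ 6) + (ℓ / r₁ ^ 2 + Mg / r₁ ^ 4)))) * (r₂ + 2 * Real.pi / β) / β) +
          β⁻¹ * ((r₂ * β / π + 1) * (2 * r₂ * (2 * π * (1 / (B.Dtmin - 2 * A) ^ 2 + Real.pi * Real.sqrt 2 * (2 + 4 * A) / (B.Dtmin - 2 * A) ^ 3) * r₂ *
            (Mg / r₁ ^ 2))))) := by
    rw [smul_eq_mul, Real.norm_eq_abs]
    simp only [hint, heK, hf]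
    exact hplanar
  have hmain := klfl_matsubara_latticeAverage_norm_le (E := ℝ) hβ hr₂.le hFc h1 h2 hlipF hFh hh0 hzero hB L
  rw [Real.coe_toNNReal _ hKnn] at hmain
  simp only [smul_eq_mul, Real.norm_eq_abs, hF, heK, hf] at hmain
  -- the lattice levels are the planar band at the lattice momenta
  have hlat : ∀ k : TorusSite 2 L, frameLevel μ K (WithLp.toLp 2 ![latticeMomentum L k 0, latticeMomentum L k 1]) = nambuXiCT L μ K k := by
    intro k
    rw [EngineV8.nambuXiCT_eq_frameLevel L μ K k]
    congr 2
    funext i; fin_cases i <;> rfl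
  simp only [hlat] at hmain
  exact hmain

/-! ## §3 In the rows door's spelling: `Σ_p G(ω_p² + e_K(p)²)·ĝ_K(p)²` -/

omit B hA hADt hlo hhi in
/-- **Dictionary**: `Σ_{(ν,k̃)} G(ω_ν² + e_K²)·ĝ_K(ν,k̃)² = Σ_k̃ Σ_ν G(s)(e_K² − ω_ν²)/s²` (a real number; frequency sum by `klod_sum_even_mul_propCT_sq`). -/
theorem klph_sum_propCT_sq_eq {L M : ℕ} [NeZero L] {β : ℝ} (hβ : β ≠ 0) (μ : ℝ) (K : TrigPolyC4v) (G : ℝ → ℝ) :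
    ∑ p : FreqMomentum L M, (G (matsubaraFreq β M p.1 ^ 2 + nambuXiCT L μ K p.2 ^ 2) : ℂ) * propCT L M β μ K p ^ 2 =
      ((∑ k : TorusSite 2 L, ∑ ν : MatsubaraIdx M, G (matsubaraFreq β M ν ^ 2 + nambuXiCT L μ K k ^ 2) *
        (nambuXiCT L μ K k ^ 2 - matsubaraFreq β M ν ^ 2) / (matsubaraFreq β M ν ^ 2 + nambuXiCT L μ K k ^ 2) ^ 2 : ℝ) : ℂ) := by
  rw [Fintype.sum_prod_type, Finset.sum_comm, Complex.ofReal_sum]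
  refine Finset.sum_congr rfl fun k _ => ?_
  exact klod_sum_even_mul_propCT_sq μ K hβ (fun ν => G (matsubaraFreq β M ν ^ 2 + nambuXiCT L μ K k ^ 2))
    (fun ν => by simp only [matsubaraFreq_rev, neg_sq]) k

/-- **The leading part of the zero-transfer p-h value rows is thermal + DOS-slope + lattice sized** (momentum sum outside, frequency sum inside):
`|β⁻¹·(L²)⁻¹·Σ_k̃ Σ_ν G(s)(e_K² − ω_ν²)/s²| ≤` the bound of `klph_lattice_rotation_le`. -/
theorem klph_lattice_rotation_le' {M : ℕ} {β : ℝ} (hβ : 0 < β) {G : ℝ → ℝ} {Mg ℓ r₁ r₂ : ℝ} (hbd : ∀ s, |G s| ≤ Mg)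
    (hlip : ∀ s s', |G s - G s'| ≤ ℓ * |s - s'|) (hin : ∀ s, s ≤ r₁ ^ 2 → G s = 0) (hout : ∀ s, r₂ ^ 2 ≤ s → G s = 0)
    (hr₁ : 0 < r₁) (hr₂ : 0 < r₂) (hr₂r : r₂ < r) (hM : β * r₂ / (2 * Real.pi) + 1 ≤ M) (L : ℕ) [NeZero L] :
    |β⁻¹ * (((L ^ 2 : ℕ) : ℝ)⁻¹ * ∑ k : TorusSite 2 L, ∑ i : MatsubaraIdx M,
        G (matsubaraFreq β M i ^ 2 + nambuXiCT L μ K k ^ 2) * (nambuXiCT L μ K k ^ 2 - matsubaraFreq β M i ^ 2) /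
          (matsubaraFreq β M i ^ 2 + nambuXiCT L μ K k ^ 2) ^ 2)| ≤
      ((2 * π) ^ 2)⁻¹ * (2 * π * (π * Real.sqrt 2 / (B.Dtmin - 2 * A)) *
            ((2 * r₂ * (2 * r₂ * (2 * r₂ ^ 2 * (ℓ / r₁ ^ 4 + 2 * Mg / r₁ ^ 6) + (ℓ / r₁ ^ 2 + Mg / r₁ ^ 4)))) * (r₂ + 2 * Real.pi / β) / β) +
          β⁻¹ * ((r₂ * β / π + 1) * (2 * r₂ * (2 * π * (1 / (B.Dtmin - 2 * A) ^ 2 + Real.pi * Real.sqrt 2 * (2 + 4 * A) / (B.Dtmin - 2 * A) ^ 3) * r₂ *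
            (Mg / r₁ ^ 2))))) +
        (r₂ / π + 3 / β) * (2 * π * (2 * r₂ * (2 * r₂ ^ 2 * (ℓ / r₁ ^ 4 + 2 * Mg / r₁ ^ 6) + (ℓ / r₁ ^ 2 + Mg / r₁ ^ 4)) * (4 + 2 * A)) / L) := by
  have h := klph_lattice_rotation_le B hA hADt hlo hhi hβ hbd hlip hin hout hr₁ hr₂ hr₂r hM L
  have e : β⁻¹ * (((L ^ 2 : ℕ) : ℝ)⁻¹ * ∑ k : TorusSite 2 L, ∑ i : MatsubaraIdx M,
        G (matsubaraFreq β M i ^ 2 + nambuXiCT L μ K k ^ 2) * (nambuXiCT L μ K k ^ 2 - matsubaraFreq β M i ^ 2) /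
          (matsubaraFreq β M i ^ 2 + nambuXiCT L μ K k ^ 2) ^ 2) =
      β⁻¹ * ∑ i : MatsubaraIdx M, ((L ^ 2 : ℕ) : ℝ)⁻¹ * ∑ k : TorusSite 2 L,
        G (matsubaraFreq β M i ^ 2 + nambuXiCT L μ K k ^ 2) * (nambuXiCT L μ K k ^ 2 - matsubaraFreq β M i ^ 2) /
          (matsubaraFreq β M i ^ 2 + nambuXiCT L μ K k ^ 2) ^ 2 := by
    rw [Finset.sum_comm, Finset.mul_sum]
  rw [e]
  exact h

end Chart

end Summit.HubbardSuperconductivity.HubbardSuperconductivity.Theorems.KLRegimeSplit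

end
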